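import Summits.QuantumFields.YangMills.Theorems.BalabanUVNodesN08AlphaLoop28
import Summits.QuantumFields.YangMills.Theorems.BalabanUVNodesN08AlphaGroupTopology

/-!
# Route «BalabanUVNodes», Track-A DAG node N08 = [Balaban1985UV3] — THE (α) CLAUSE: the in-edge face `measUk` («`U_k(·, h)` is
# measurable», [7] Thm 1 + Prop 9) IS INHABITED BY MEASURABLE MINIMISER SELECTIONS, at every group AS PRINTED

Cell `pub-ymgap`, seat `pub-ymgap-dag-n08-d` gen 4, file 1b = part 2 of 2 (director-ym R134 row «CLASS-I in-edge conclusions at the (α) granularity of `RunAlpha`: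
… discharge the species-OK interfaces `h68 ∕ hU ∕ h44 ∕ hLF67`»; the located item L2 of the lineage's census
`HOME/pub-ymgap-dag-n08-d/N08-ALPHA-LOCATED-g3.md`: «`measUk` … candidate mechanism = Kuratowski–Ryll-Nardzewski measurable argmin selection
… with G's topology via `GroupModel.ρ`»).  `bears_on: R4∕N08`; filed `--supports stmt-QuantumFields-19903 --as helper`.  Sorry-free, standard axioms.

THE INTERFACE `hU`.  In the d = 3 lane's (α) inputs (`UVStability3DInputs.StepAlpha.hU`; in this lineage the field `measUk` of
`BalabanUVNodesN08AlphaClassI.InEdgeFaces` ∕ `BalabanUVNodesN08AlphaLoop28.InEdgeFaces₃`) the EXTERNAL input `X : Carriers.ExternalInputs S G` must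
carry measurable composite-minimiser maps `X.UkH k h : GaugeField S.P k G → GaugeField S.P 0 G` — print's `U_k(V, h)` of (42) p. 266, «a minimum of
the functional U → A^η(U), U: Ū^j = V_j on Λ_j, j = 0, 1, …, k» ([7] (3)∕(5)∕(6), Thm 1 p. 279).  Print gets measurability from the ANALYTICITY of
`V ↦ U_k(V)` on the small-field constraint space ([7] Prop. 9); the lane's map is TOTAL in `V`.  This file shows that the face is inhabited WITHOUT
[7]: for every group as printed the constrained minimisation (42) admits a MEASURABLE SELECTION of minimisers (Castaing ∕ Kuratowski–Ryll-Nardzewski,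
tree `Literature.MeasureTheory.RandomSets.exists_measurable_constrained_argmin`, as NODE 00's `Node00/Record12MinimiserSelection` did for the d = 4
programme's (2.12) at `SU(N)`), so external inputs whose `U_k(·, h)` ARE minimisers of (42) AND are measurable EXIST.

WHAT THIS FILE PROVES (kernel; [folklore] measure theory over the tree's own objects; part 1 = `BalabanUVNodesN08AlphaGroupTopology`: the
topology `rhoTopology 𝔊` of a group as printed — compact Polish topological group, Borel σ-algebra = the given one — and the continuity of the printed
maps on the configuration spaces):
* §2b `fibre42 av k B O W = {U ∈ O | (Ū^j)_b = (W_j)_b, b ∈ B_j, j ≤ k}` — [7] (3)∕(6) = (42) as a SET at a general group and averaging family.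
* §3 SELECTION AT A GROUP AS PRINTED: `exists_measurable_constrainedMin_rho` — for an open regularity class, a σ-closed-continuous constraint map into
  any target whose σ-algebra contains the open sets, a closed constraint relation and a continuous objective there is a MEASURABLE map of the
  parameter selecting a constrained minimiser wherever one exists (a default value elsewhere); `exists_measurable_min42Sel_rho` — the (42)-shape, for
  ANY averaging family with σ-closed-continuous maps and any measurable multi-scale datum `W = π x` of the parameter.
* §4 THE FACE: `measurable_ukH_of_triv` (glue at the trivial history through `ExternalInputs.UkH_triv` ∕ `Carriers.ukAll`) and
  ★ `exists_externalInputs_measUk`: for any external inputs `X₀` whose averaging maps are σ-closed-continuous in the topology of part 1 (e.g. the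
  lane's standard family — `exists_externalInputs_measUk_std`, by part 1's `continuous_stdAvg`), any continuous objective, open regularity classes
  `O k h`, constraint bonds `B k h` and measurable data embeddings `ι k h : V ↦ (V_j)_{j ≤ k}` (the retained variables of the history baked in —
  census L5), there are external inputs `X` with the SAME `av`, `reg` whose `X.UkH k h` (`h ≠` trivial) and `X.Uk k` are (42)-minimisers on the
  solvable set AND are measurable for EVERY `k, h` — so the field `measUk : ∀ k, k + 1 ≤ S.K → ∀ h, Measurable (X.UkH k h)` of
  `InEdgeFaces₃ 𝔊 𝔠 X` ∕ `InEdgeFaces 𝔊 𝔠 X 𝔏` (and `StepAlpha.hU`) holds for them.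
HONEST FRAMING — what this is NOT.  [7] Thm 1 (existence ∕ uniqueness-modulo-gauge ∕ analyticity of `U_k(V)`) is NOT used and NOT asserted: a selector
needs neither, and where (42) has no minimiser in the class the selected value is the documented default `1`.  The faces `inB42` ∕ `reg2` (VALUES of
`U_k(·, h)`: constraint membership at an `h`-large field history, regularity (2)∕(8) on `Ω_j(h)`) stay displayed exactly as in gen 2∕3; nothing of
[B10] is asserted; count-neutral; NOT a discharge of N08.  d = 3 lattice gauge theory on finite tori as printed; nothing about d = 4, the continuum,
OS axioms, a mass gap or the Clay problem.
-/

noncomputable section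

namespace Summit.QuantumFields.YangMills.Theorems.BalabanUVNodesN08AlphaMeasUk

open MeasureTheory Set Topology TopologicalSpace
open scoped Matrix
open Literature.MeasureTheory.RandomSets
open Literature.MathematicalPhysics.QuantumFieldTheory.Balaban1983to89
open Literature.MathematicalPhysics.QuantumFieldTheory.Balaban1983to89.AveragingRT (pathProd axialAvg axial axial_avg transportAvg stdAvg)
open Literature.MathematicalPhysics.QuantumFieldTheory.Balaban1985CMP102.Setting
open Summit.QuantumFields.Balaban3D.Carriers
open Summit.QuantumFields.YangMills.Theorems.BalabanUVNodesN08AlphaGroupTopology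

/-! ## §2b The constraint space of (42) at a general group and averaging -/

section ConstraintSpace

variable {P : Params} {G : Type*} [GaugeGroup G]

/-- **[7] (3)∕(6) = [Balaban1985UV3] (42) AS A SET, at a general group and averaging**: the configurations of the regularity class `O` whose
`j`-fold averages agree with the datum `W_j` on the constraint bonds `B_j`, `j ≤ k` — «U: Ū^j = V_j on Λ_j, j = 0, 1, …, k» (print: `Ū^j` the
average of [4], `B_j` the bonds of `Λ_j`, `O` = [7]'s `U_k({Ω_j}, ε)`; the tree's `B10Eq42TorusConstraint.Constraint42` is the `U(N)`-instance
with print's averaging `avgT`). [cite: Balaban1985UV3, (42) p.266; Balaban1985Variational, (3)+(6) p.278] -/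
def fibre42 (av : ∀ j, Averaging P j G) (k : ℕ) (B : (j : ℕ) → Set (PBond P j)) (O : Set (GaugeField P 0 G))
    (W : (j : Fin (k + 1)) → GaugeField P j G) : Set (GaugeField P 0 G) :=
  {U | U ∈ O ∧ ∀ j : Fin (k + 1), ∀ b ∈ B j, Averaging.iter av j U b = W j b}

/-- Membership in the constraint space, unfolded. [cite: Balaban1985UV3, (42) p.266] -/
theorem mem_fibre42_iff {av : ∀ j, Averaging P j G} {k : ℕ} {B : (j : ℕ) → Set (PBond P j)} {O : Set (GaugeField P 0 G)}
    {W : (j : Fin (k + 1)) → GaugeField P j G} {U : GaugeField P 0 G} :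
    U ∈ fibre42 av k B O W ↔ U ∈ O ∧ ∀ j : Fin (k + 1), ∀ b ∈ B j, Averaging.iter av j U b = W j b :=
  Iff.rfl

end ConstraintSpace

/-! ## §3 Measurable selection of constrained minimisers at a group as printed -/

section Selection

variable {G : Type} [GaugeGroup G] [MeasurableSpace G] (𝔊 : GroupModel G) {P : Params}

/-- **MEASURABLE SELECTION OF CONSTRAINED MINIMISERS AT A GROUP AS PRINTED.**  `G` a group as printed with the topology of its realisation (§1),
configurations `GaugeField P i G = (bonds → G)` (compact Polish, Borel = the product σ-algebra); `O` an OPEN regularity class; `g` a constraint map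
into a topological space `Z` whose σ-algebra contains the open sets, continuous on each member of a countable closed cover (`SigmaClosedContinuous`);
`R ⊆ Z × Z` a CLOSED relation; `π` a measurable datum of the parameter `x ∈ X`; `A` a CONTINUOUS objective.  Then there is a MEASURABLE `f : X →
GaugeField P i G` such that `f x` minimises `A` over `{U ∈ O | (g U, π x) ∈ R}` whenever that problem has a minimiser, and `f x = U₁` otherwise —
the tree's `exists_measurable_constrained_argmin` (Castaing's compact-valued selection over countably many compact pieces) at these carriers.
[cite: Balaban1985Variational, Thm 1 p.279 (measurable-selection reading; existence NOT used)] -/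
theorem exists_measurable_constrainedMin_rho {i : ℕ} {X : Type*} [MeasurableSpace X] {Z : Type*} [TopologicalSpace Z] [MeasurableSpace Z]
    [OpensMeasurableSpace Z] {π : X → Z} (hπ : Measurable π) {g : GaugeField P i G → Z}
    (hg : letI := rhoTopology 𝔊; SigmaClosedContinuous g) {O : Set (GaugeField P i G)} (hO : letI := rhoTopology 𝔊; IsOpen O)
    {R : Set (Z × Z)} (hR : IsClosed R) {A : GaugeField P i G → ℝ} (hA : letI := rhoTopology 𝔊; Continuous A) (U₁ : GaugeField P i G) :
    ∃ f : X → GaugeField P i G, Measurable f ∧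
      (∀ x, (∃ U, (U ∈ O ∧ (g U, π x) ∈ R) ∧ ∀ U', U' ∈ O ∧ (g U', π x) ∈ R → A U ≤ A U') →
        (f x ∈ O ∧ (g (f x), π x) ∈ R) ∧ ∀ U', U' ∈ O ∧ (g U', π x) ∈ R → A (f x) ≤ A U') ∧
      (∀ x, ¬ (∃ U, (U ∈ O ∧ (g U, π x) ∈ R) ∧ ∀ U', U' ∈ O ∧ (g U', π x) ∈ R → A U ≤ A U') → f x = U₁) := by
  letI := rhoTopology 𝔊
  haveI := compactSpace_rho 𝔊
  haveI := secondCountableTopology_rho 𝔊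
  haveI := polishSpace_rho 𝔊
  haveI := borelSpace_rho 𝔊
  haveI : CompactSpace (GaugeField P i G) := inferInstanceAs (CompactSpace (PBond P i → G))
  haveI : PolishSpace (GaugeField P i G) := inferInstanceAs (PolishSpace (PBond P i → G))
  haveI : SecondCountableTopology (GaugeField P i G) := inferInstanceAs (SecondCountableTopology (PBond P i → G))
  haveI : BorelSpace (GaugeField P i G) := inferInstanceAs (BorelSpace (PBond P i → G))
  exact exists_measurable_constrained_argmin hπ hg hO hR hA U₁

/-- **MEASURABLE SELECTION OF (42)-MINIMISERS AT A GROUP AS PRINTED.**  For any averaging family `av` whose maps are σ-closed-continuous in the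
topology of §1 (e.g. continuous: the lane's standard family, §2; or NODE 00's exp-mean-log averaging), any level `k`, constraint bonds `B_j`, open
class `O`, continuous objective `A` and measurable multi-scale datum `π x = (W_j)_{j ≤ k}` of the parameter: a MEASURABLE `f` with `f x` a minimiser
of `A` on `fibre42 av k B O (π x)` whenever one exists (`U₁` otherwise). [cite: Balaban1985UV3, (42) p.266; Balaban1985Variational, Thm 1 p.279 (measurable-selection reading; existence NOT used)] -/
theorem exists_measurable_min42Sel_rho (av : ∀ j, Averaging P j G) (hav : letI := rhoTopology 𝔊; ∀ j, SigmaClosedContinuous (av j).avg)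
    (k : ℕ) (B : (j : ℕ) → Set (PBond P j)) {O : Set (GaugeField P 0 G)} (hO : letI := rhoTopology 𝔊; IsOpen O)
    {A : GaugeField P 0 G → ℝ} (hA : letI := rhoTopology 𝔊; Continuous A) {X : Type*} [MeasurableSpace X]
    {π : X → (j : Fin (k + 1)) → GaugeField P j G} (hπ : Measurable π) (U₁ : GaugeField P 0 G) :
    ∃ f : X → GaugeField P 0 G, Measurable f ∧
      (∀ x, (∃ U ∈ fibre42 av k B O (π x), IsMinOn A (fibre42 av k B O (π x)) U) →
        f x ∈ fibre42 av k B O (π x) ∧ IsMinOn A (fibre42 av k B O (π x)) (f x)) ∧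
      (∀ x, ¬ (∃ U ∈ fibre42 av k B O (π x), IsMinOn A (fibre42 av k B O (π x)) U) → f x = U₁) := by
  letI := rhoTopology 𝔊
  haveI := compactSpace_rho 𝔊
  haveI := secondCountableTopology_rho 𝔊
  haveI := polishSpace_rho 𝔊
  haveI := borelSpace_rho 𝔊
  haveI : ∀ j, SecondCountableTopology (GaugeField P j G) := fun j => inferInstanceAs (SecondCountableTopology (PBond P j → G))
  haveI : ∀ j, BorelSpace (GaugeField P j G) := fun j => inferInstanceAs (BorelSpace (PBond P j → G))
  -- the constraint map, the closed relation
  let Z : Type := (j : Fin (k + 1)) → GaugeField P j G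
  let g : GaugeField P 0 G → Z := fun U j => Averaging.iter av j U
  let R : Set (Z × Z) := {p | ∀ j : Fin (k + 1), ∀ b ∈ B j, p.1 j b = p.2 j b}
  have hg : SigmaClosedContinuous g := sigmaClosedContinuous_iterUpTo hav k
  have hcoord : ∀ (j : Fin (k + 1)) (b : PBond P j), Continuous fun z : Z => z j b := fun j b =>
    (show Continuous fun V : GaugeField P j G => V b from continuous_apply b).comp (continuous_apply j)
  have hR : IsClosed R := by
    simp only [R, setOf_forall]
    refine isClosed_iInter fun j => isClosed_iInter fun b => isClosed_iInter fun _ => ?_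
    exact isClosed_eq ((hcoord j b).comp continuous_fst) ((hcoord j b).comp continuous_snd)
  have hadm : ∀ (U : GaugeField P 0 G) (x : X), (U ∈ O ∧ (g U, π x) ∈ R) ↔ U ∈ fibre42 av k B O (π x) := fun U x => Iff.rfl
  obtain ⟨f, hfm, hfin, hfout⟩ := exists_measurable_constrainedMin_rho 𝔊 (i := 0) hπ hg hO hR hA U₁
  refine ⟨f, hfm, fun x hx => ?_, fun x hx => ?_⟩
  · obtain ⟨U₀, hU₀, hmin⟩ := hx
    have hex : ∃ U, (U ∈ O ∧ (g U, π x) ∈ R) ∧ ∀ U', U' ∈ O ∧ (g U', π x) ∈ R → A U ≤ A U' :=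
      ⟨U₀, (hadm U₀ x).mpr hU₀, fun U' hU' => hmin ((hadm U' x).mp hU')⟩
    obtain ⟨hf₁, hf₂⟩ := hfin x hex
    exact ⟨(hadm (f x) x).mp hf₁, fun U' hU' => hf₂ U' ((hadm U' x).mpr hU')⟩
  · refine hfout x fun h => hx ?_
    obtain ⟨U₀, hU₀, hmin⟩ := h
    exact ⟨U₀, (hadm U₀ x).mp hU₀, fun U' hU' => hmin U' ((hadm U' x).mpr hU')⟩

end Selection

/-! ## §4 The face `measUk`: external inputs whose `U_k(·, h)` are measurable (42)-minimiser selections -/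

section Face

variable {L : ℕ} {S : Scales L} {G : Type} [GaugeGroup G] [MeasurableSpace G] [HaarData G]

omit [GaugeGroup G] [HaarData G] in
/-- **GLUE AT THE TRIVIAL HISTORY.**  If the one-argument minimisers `U_k(V)` are measurable and the composite ones `U_k(V, h)` are measurable at
every NON-trivial history, then — the trivial history being tied to `U_k(V)` by `ExternalInputs.UkH_triv` (`UkH k triv = ukAll Uk k`: the
identity at `k = 0`, `Uk (k−1)` above) — every `U_k(·, h)` is measurable. [cite: Balaban1985UV3, (42) p.266 (bookkeeping)] -/
theorem measurable_ukH_of_triv (Uk : (k : ℕ) → GaugeField S.P (k + 1) G → GaugeField S.P 0 G)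
    (UkH : (k : ℕ) → Hist S.P k → GaugeField S.P k G → GaugeField S.P 0 G)
    (htriv : ∀ (k : ℕ) (V : GaugeField S.P k G), UkH k (Hist.triv S.P k) V = ukAll Uk k V)
    (hUk : ∀ k, Measurable (Uk k)) (hUkH : ∀ k (h : Hist S.P k), h ≠ Hist.triv S.P k → Measurable (UkH k h))
    (k : ℕ) (h : Hist S.P k) : Measurable (UkH k h) := by
  by_cases hh : h = Hist.triv S.P k
  · subst hh
    rw [show UkH k (Hist.triv S.P k) = ukAll Uk k from funext (htriv k)]
    cases k with
    | zero => exact measurable_id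
    | succ k => exact hUk k
  · exact hUkH k h hh

open Classical in
/-- **★ THE FACE `measUk` IS INHABITED BY MINIMISER SELECTIONS, AT EVERY GROUP AS PRINTED.**  Let `X₀` be external inputs whose averaging maps
`Ū` are σ-closed-continuous in the topology of the realisation (§1), `A` a continuous objective (e.g. `A^η = Setup.wilsonAction`, §2), and for every
step `k` and history `h`: an OPEN regularity class `O k h` ([7]'s `U_k({Ω_j(h)}, ε)`), constraint bonds `B k h j` (the bonds of `Λ_j(h)`) and a
MEASURABLE data embedding `ι k h : V ↦ (V_j)_{j ≤ k}` (`V_k = V`, the retained large-field variables `V_j`, `j < k`, of the history baked in — census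
L5).  Then there are external inputs `X` with THE SAME averaging and regular classes (`X.av = X₀.av`, `X.reg = X₀.reg`) such that
(i) EVERY `X.UkH k h` is measurable — so the field `measUk : ∀ k, k + 1 ≤ S.K → ∀ h, Measurable (X.UkH k h)` of `InEdgeFaces₃ 𝔊 𝔠 X` ∕
`InEdgeFaces 𝔊 𝔠 X 𝔏` ∕ `StepAlpha.hU` holds for `X`;
(ii) at every non-trivial history, `X.UkH k h V` is a minimiser of `A` on the constraint space `fibre42 X₀.av k (B k h) (O k h) (ι k h V)` of (42)
whenever that problem has one;
(iii) `X.Uk k V` (= `X.UkH (k+1) triv V` by `UkH_triv`) is a minimiser of the trivial-history problem at level `k + 1` whenever it has one;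
(iv)–(v) where (42) has NO minimiser in the class the value is the unit configuration `1` (so every value lies in `O k h ∪ {1}` — the hook for the
face `reg2`); `X.UkH 0 triv = id` is the lane's convention `ukAll … 0 = id`.  A measurable-selection
theorem replaces [7] Prop. 9's analyticity; [7] Thm 1 is NOT used. [cite: Balaban1985UV3, (42) p.266; Balaban1985Variational, Thm 1 p.279 + Prop 9 p.309 (measurable-selection reading)] -/
theorem exists_externalInputs_measUk (𝔊 : GroupModel G) (X₀ : ExternalInputs S G)
    (hav : letI := rhoTopology 𝔊; ∀ j, SigmaClosedContinuous (X₀.av j).avg)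
    {A : GaugeField S.P 0 G → ℝ} (hA : letI := rhoTopology 𝔊; Continuous A)
    (O : (k : ℕ) → Hist S.P k → Set (GaugeField S.P 0 G)) (hO : letI := rhoTopology 𝔊; ∀ k h, IsOpen (O k h))
    (B : (k : ℕ) → Hist S.P k → (j : ℕ) → Set (PBond S.P j))
    (ι : (k : ℕ) → Hist S.P k → GaugeField S.P k G → ((j : Fin (k + 1)) → GaugeField S.P j G))
    (hι : ∀ k h, Measurable (ι k h)) :
    ∃ X : ExternalInputs S G, X.av = X₀.av ∧ X.reg = X₀.reg ∧
      (∀ (k : ℕ) (h : Hist S.P k), Measurable (X.UkH k h)) ∧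
      (∀ (k : ℕ) (h : Hist S.P k) (V : GaugeField S.P k G), h ≠ Hist.triv S.P k →
        (∃ U ∈ fibre42 X₀.av k (B k h) (O k h) (ι k h V), IsMinOn A (fibre42 X₀.av k (B k h) (O k h) (ι k h V)) U) →
          X.UkH k h V ∈ fibre42 X₀.av k (B k h) (O k h) (ι k h V) ∧
            IsMinOn A (fibre42 X₀.av k (B k h) (O k h) (ι k h V)) (X.UkH k h V)) ∧
      (∀ (k : ℕ) (V : GaugeField S.P (k + 1) G),
        (∃ U ∈ fibre42 X₀.av (k + 1) (B (k + 1) (Hist.triv S.P (k + 1))) (O (k + 1) (Hist.triv S.P (k + 1)))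
            (ι (k + 1) (Hist.triv S.P (k + 1)) V),
          IsMinOn A (fibre42 X₀.av (k + 1) (B (k + 1) (Hist.triv S.P (k + 1))) (O (k + 1) (Hist.triv S.P (k + 1)))
            (ι (k + 1) (Hist.triv S.P (k + 1)) V)) U) →
          X.Uk k V ∈ fibre42 X₀.av (k + 1) (B (k + 1) (Hist.triv S.P (k + 1))) (O (k + 1) (Hist.triv S.P (k + 1)))
              (ι (k + 1) (Hist.triv S.P (k + 1)) V) ∧
            IsMinOn A (fibre42 X₀.av (k + 1) (B (k + 1) (Hist.triv S.P (k + 1))) (O (k + 1) (Hist.triv S.P (k + 1)))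
              (ι (k + 1) (Hist.triv S.P (k + 1)) V)) (X.Uk k V)) ∧
      (∀ (k : ℕ) (h : Hist S.P k) (V : GaugeField S.P k G), h ≠ Hist.triv S.P k →
        ¬ (∃ U ∈ fibre42 X₀.av k (B k h) (O k h) (ι k h V), IsMinOn A (fibre42 X₀.av k (B k h) (O k h) (ι k h V)) U) →
          X.UkH k h V = 1) ∧
      (∀ (k : ℕ) (V : GaugeField S.P (k + 1) G),
        ¬ (∃ U ∈ fibre42 X₀.av (k + 1) (B (k + 1) (Hist.triv S.P (k + 1))) (O (k + 1) (Hist.triv S.P (k + 1)))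
            (ι (k + 1) (Hist.triv S.P (k + 1)) V),
          IsMinOn A (fibre42 X₀.av (k + 1) (B (k + 1) (Hist.triv S.P (k + 1))) (O (k + 1) (Hist.triv S.P (k + 1)))
            (ι (k + 1) (Hist.triv S.P (k + 1)) V)) U) →
          X.Uk k V = 1) := by
  -- one measurable selector per (k, h)
  have H : ∀ (k : ℕ) (h : Hist S.P k), ∃ f : GaugeField S.P k G → GaugeField S.P 0 G, Measurable f ∧
      (∀ V, (∃ U ∈ fibre42 X₀.av k (B k h) (O k h) (ι k h V), IsMinOn A (fibre42 X₀.av k (B k h) (O k h) (ι k h V)) U) →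
        f V ∈ fibre42 X₀.av k (B k h) (O k h) (ι k h V) ∧ IsMinOn A (fibre42 X₀.av k (B k h) (O k h) (ι k h V)) (f V)) ∧
      (∀ V, ¬ (∃ U ∈ fibre42 X₀.av k (B k h) (O k h) (ι k h V), IsMinOn A (fibre42 X₀.av k (B k h) (O k h) (ι k h V)) U) →
        f V = 1) :=
    fun k h => exists_measurable_min42Sel_rho 𝔊 X₀.av hav k (B k h) (hO k h) hA (hι k h) 1
  choose F hFm hFmin hFout using H
  -- the new minimiser fields: `Uk k` = the selector of the trivial history at level `k+1`; `UkH` patched at the trivial history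
  let Uk : (k : ℕ) → GaugeField S.P (k + 1) G → GaugeField S.P 0 G := fun k => F (k + 1) (Hist.triv S.P (k + 1))
  let UkH : (k : ℕ) → Hist S.P k → GaugeField S.P k G → GaugeField S.P 0 G :=
    fun k h V => if h = Hist.triv S.P k then ukAll Uk k V else F k h V
  have htriv : ∀ (k : ℕ) (V : GaugeField S.P k G), UkH k (Hist.triv S.P k) V = ukAll Uk k V := fun k V => by
    simp only [UkH, if_true]
  have hne : ∀ (k : ℕ) (h : Hist S.P k), h ≠ Hist.triv S.P k → UkH k h = F k h := fun k h hh => by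
    funext V
    simp only [UkH, if_neg hh]
  refine ⟨{ X₀ with Uk := Uk, UkH := UkH, UkH_triv := htriv }, rfl, rfl, ?_, ?_, ?_, ?_, ?_⟩
  · intro k h
    refine measurable_ukH_of_triv Uk UkH htriv (fun k => hFm (k + 1) _) (fun k h hh => ?_) k h
    rw [hne k h hh]
    exact hFm k h
  · intro k h V hh hex
    have hval : UkH k h V = F k h V := by rw [hne k h hh]
    simp only [hval]
    exact hFmin k h V hex
  · intro k V hex
    exact hFmin (k + 1) (Hist.triv S.P (k + 1)) V hex
  · intro k h V hh hno
    have hval : UkH k h V = F k h V := by rw [hne k h hh]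
    simp only [hval]
    exact hFout k h V hno
  · intro k V hno
    exact hFout (k + 1) (Hist.triv S.P (k + 1)) V hno

/-- **THE SAME FOR THE LANE'S STANDARD EXTERNAL INPUTS** (`ExternalInputs.ofStd`: averaging `AveragingRT.stdAvg`, whose maps are CONTINUOUS in the
topology of the realisation by §1–§2, so the continuity hypothesis of `exists_externalInputs_measUk` is a theorem): for any regular classes, open
regularity classes `O k h`, constraint bonds, measurable data embeddings and continuous objective there are external inputs with `X.av = stdAvg`
whose `U_k(·, h)` are measurable (42)-minimiser selections. [cite: Balaban1985UV3, (42) p.266; Balaban1985Variational, Thm 1 p.279 (measurable-selection reading)] -/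
theorem exists_externalInputs_measUk_std (𝔊 : GroupModel G) (X₀ : ExternalInputs S G) (hstd : X₀.av = AveragingRT.stdAvg S.P G)
    {A : GaugeField S.P 0 G → ℝ} (hA : letI := rhoTopology 𝔊; Continuous A)
    (O : (k : ℕ) → Hist S.P k → Set (GaugeField S.P 0 G)) (hO : letI := rhoTopology 𝔊; ∀ k h, IsOpen (O k h))
    (B : (k : ℕ) → Hist S.P k → (j : ℕ) → Set (PBond S.P j))
    (ι : (k : ℕ) → Hist S.P k → GaugeField S.P k G → ((j : Fin (k + 1)) → GaugeField S.P j G))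
    (hι : ∀ k h, Measurable (ι k h)) :
    ∃ X : ExternalInputs S G, X.av = AveragingRT.stdAvg S.P G ∧ X.reg = X₀.reg ∧
      (∀ (k : ℕ) (h : Hist S.P k), Measurable (X.UkH k h)) ∧
      (∀ (k : ℕ) (h : Hist S.P k) (V : GaugeField S.P k G), h ≠ Hist.triv S.P k →
        (∃ U ∈ fibre42 X₀.av k (B k h) (O k h) (ι k h V), IsMinOn A (fibre42 X₀.av k (B k h) (O k h) (ι k h V)) U) →
          X.UkH k h V ∈ fibre42 X₀.av k (B k h) (O k h) (ι k h V) ∧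
            IsMinOn A (fibre42 X₀.av k (B k h) (O k h) (ι k h V)) (X.UkH k h V)) ∧
      (∀ (k : ℕ) (h : Hist S.P k) (V : GaugeField S.P k G), h ≠ Hist.triv S.P k →
        ¬ (∃ U ∈ fibre42 X₀.av k (B k h) (O k h) (ι k h V), IsMinOn A (fibre42 X₀.av k (B k h) (O k h) (ι k h V)) U) →
          X.UkH k h V = 1) := by
  have hav : letI := rhoTopology 𝔊; ∀ j, SigmaClosedContinuous (X₀.av j).avg := by
    letI := rhoTopology 𝔊
    haveI := continuousMul_rho 𝔊
    intro j
    rw [hstd]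
    exact SigmaClosedContinuous.of_continuous (continuous_stdAvg j)
  obtain ⟨X, hXav, hXreg, hm, hmin, -, hout, -⟩ := exists_externalInputs_measUk 𝔊 X₀ hav hA O hO B ι hι
  exact ⟨X, hXav.trans hstd, hXreg, hm, hmin, hout⟩

end Face

end Summit.QuantumFields.YangMills.Theorems.BalabanUVNodesN08AlphaMeasUk

end
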